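import Summits.QuantumFields.YangMills.Theorems.UnitScaleTiltProp7SPrintDefsS
import HarnessLib

/-!
# Route `UnitScaleTilt`, crux «MinimiserStabilityRegPr» (stmt-QuantumFields-19200, stub EX, route (α)) — THE FIRST-ORDER `L²`-LETTER DICTIONARY AT THE T³ OBJECTS:
# brick L0a's (3.3)∕(3.8) `DL2`∕`DstarL2` (and the readback `DstarPi`) READ ON THE ROUTE CARRIERS ARE `T3SectALandauChart.covDerivFwdT η`∕`covDivFormT η` at `bgUnits U₀`,
# `η = eta F n K`; hence the projected Landau member `IsLandauPrintS U₀ X` ((21)ˢ of the EX knit) IS «`R_S(U₀)(D^{η*}_{U₀}X) = 0`» in the route's divergence letter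

Cell `ym3-torus` (HUMAN RULING D-0037, YM ladder rung R3 — YM₃ on T³, NOT d = 4, NOT Clay; YM gap NOT proved), width seat `ym3-torus-px16` (explicit-unit;
`--supports stmt-QuantumFields-19200 --as helper`, count-neutral; NO claim on crux∕stub∕registry).  THEOREMS ONLY (0 `def`, 0 `sorry`).  Companion of
`…Prop7SecondOrderDictT3` (row «hDict2» of LOCATE-HDSOL-136-px16, 19200 evidence #52): there the UNIT-lattice one-form calculus of `T3SectALandauChart` §2 was
identified with lit-balaban's `B9Eq39Adjoint` operators on `torusT`; here the `L²` letters of ✓`Prop7SectET3HilbertLettersT3` (`DL2`, `DstarL2`, `DstarPi`), in which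
the N06(d = 3) record chain and the EX knit's `IsLandauPrintS` are written, are identified with the SAME route letters at spacing `η`.

THE PRINT.  [Balaban1985BackgroundPropagators] (3.3) p. 391 `(D^η_{U,μ}λ)(x) = η⁻¹(R(U(x,x+ηe_μ))λ(x+ηe_μ) − λ(x))`; (3.8) p. 392 `(D*A)(x) = Σ_μ η⁻¹(R(U(x,x−ηe_μ))A(x−ηe_μ,x)
− A(x,x+ηe_μ))`; [Balaban1985Variational] (21) p. 281 «R(U₀)D^{η*}_{U₀}A = 0»; [Balaban1985RegularSpaces] (1.1)–(1.2) p. 76, (1.38) p. 82.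

WHAT IS PROVED (member `F`, heights `n K`, weight `c₀`, background `U₀ : GaugeField (F.P K) 0 SU(2)`):
* `bgOfCfg_bondEquiv` (`bgOfCfg F K U₀ (bondEquiv F K b) = bgUnits F K U₀ b`), `siteEquiv_symm_unshift`, `bondEquiv_symm_unshift` (index transport);
* ★`DL2_toL2S_eq_covDerivFwdT` — `(toL2)⁻¹ (DL2 U₀ (toL2S λ)) b = covDerivFwdT η (bgUnits F K U₀) b.dir λ b.src` ((3.3) = (1.1)₁ at the member);
* ★`DstarPi_eq_covDivFormT` — `DstarPi F n K c₀ U₀ X = fun x ↦ covDivFormT η (bgUnits F K U₀) X x` ((3.8) = (1.2) at the member), `DstarL2_toL2_eq_covDivFormT`;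
* ★★`isLandauPrintS_iff_covDivFormT` — `IsLandauPrintS F n K h c₀ cB U₀ X ↔ RSPi F n K h c₀ cB U₀ (fun x ↦ covDivFormT (eta F n K) (bgUnits F K U₀) X x) = 0`.
HONEST SCOPE.  Re-indexing + one scalar (`((η:ℝ):ℂ)⁻¹ • = η⁻¹ •`); nothing of print asserted; no estimate.

References: T. Bałaban, CMP **99** (1985) 389–434 [Balaban1985BackgroundPropagators] ((3.3), (3.5), (3.8) pp.391–392); CMP **102** (1985) 277–309 [Balaban1985Variational]
((21) p.281); CMP **99** (1985) 75–102 [Balaban1985RegularSpaces] ((1.1)–(1.2) p.76, (1.38) p.82).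
-/

set_option autoImplicit false

noncomputable section

open scoped Matrix.Norms.L2Operator

namespace Summit.QuantumFields.YangMills.Theorems.Prop7LandauDict

open Literature.MathematicalPhysics.QuantumFieldTheory.Balaban1983to89
open Literature.MathematicalPhysics.QuantumFieldTheory.Balaban1983to89.T3ContinuumYM3Torus
open T3SectALandauChart (covDerivFwdT formComp covDivFormT bgUnits eta eta_pos)
open B10Eq68TorusRegularity (covDerivT)
open B7Eq78Linearization (conjR)
open B10Eq27TorusAxialLog (unitsField toUField)
open Summit.QuantumFields.YangMills.Theorems.Prop7SectET3Transport (periodsT3 siteEquiv bondEquiv bgOfCfg cfgEquiv siteEquiv_symm_shift bondEquiv_symm_apply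
  val_bgOfCfg)
open Summit.QuantumFields.YangMills.Theorems.Prop7SectET3HilbertLetters (W₂ toL2 toL2S DL2 DstarL2 DL2_apply DstarL2_apply)
open Summit.QuantumFields.YangMills.Theorems.Prop7SectET3GaugeProjector (RSPi DstarPi DstarPi_apply)
open Summit.QuantumFields.YangMills.Theorems.Prop7SPrint (IsLandauPrintS)

variable (F : T3Family) (n K : ℕ) (c₀ : ℝ)

/-! ## §1 Index transport -/

/-- The [B11] background at a transported bond is the route's `bgUnits` at that bond. [cite: Balaban1985Averaging, (19) p.21] -/
theorem bgOfCfg_bondEquiv (U₀ : GaugeField (F.P K) 0 (Matrix.specialUnitaryGroup (Fin 2) ℂ)) (b : PBond (F.P K) 0) :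
    bgOfCfg F K U₀ (bondEquiv F K b) = bgUnits F K U₀ b := by
  apply Units.ext
  rw [val_bgOfCfg, Equiv.symm_apply_apply]
  rfl

/-- The inverse chart carries lit-balaban's backward step to the route's: `e⁻¹(y − e_μ) = (e⁻¹ y) − e_μ`. [folklore] -/
theorem siteEquiv_symm_unshift (y : B4Sect5Torus.TSite 3 (periodsT3 F K)) (μ : Fin 3) :
    (siteEquiv F K).symm (B9SectCLatticeCarrier.unshift μ y) = ((siteEquiv F K).symm y).unshift μ := by
  have h := siteEquiv_symm_shift F K (B9SectCLatticeCarrier.unshift μ y) μ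
  rw [B9SectCLatticeCarrier.shift_unshift] at h
  rw [← Site.unshift_shift (((siteEquiv F K).symm (B9SectCLatticeCarrier.unshift μ y))) μ, ← h]

/-- … for the route's own site: `e⁻¹((e x) − e_μ) = x − e_μ`. [folklore] -/
theorem siteEquiv_symm_unshift_siteEquiv (x : Site (F.P K) 0) (μ : Fin 3) :
    (siteEquiv F K).symm (B9SectCLatticeCarrier.unshift μ (siteEquiv F K x)) = x.unshift μ := by
  rw [siteEquiv_symm_unshift, Equiv.symm_apply_apply]

/-- … for bonds: the transported backward bond is the route's bond `⟨x − e_μ, μ⟩`. [folklore] -/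
theorem bondEquiv_symm_unshift (x : Site (F.P K) 0) (μ : Fin 3) :
    (bondEquiv F K).symm (B9SectCLatticeCarrier.unshift μ (siteEquiv F K x), μ) = ⟨x.unshift μ, μ⟩ := by
  rw [bondEquiv_symm_apply, siteEquiv_symm_unshift_siteEquiv]

/-- … and the unshifted forward bond is `⟨x, μ⟩`. [folklore] -/
theorem bondEquiv_symm_siteEquiv (x : Site (F.P K) 0) (μ : Fin 3) :
    (bondEquiv F K).symm (siteEquiv F K x, μ) = ⟨x, μ⟩ := by
  rw [bondEquiv_symm_apply, Equiv.symm_apply_apply]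

/-! ## §2 (3.3) and (3.8) on the route carriers are `covDerivFwdT η` and `covDivFormT η` -/

variable [Fact (0 < c₀)]

/-- The complex scalar `((η:ℝ):ℂ)⁻¹` acts as the real scalar `η⁻¹`. [folklore] -/
theorem inv_coe_smul_eq (η : ℝ) (X : Matrix (Fin 2) (Fin 2) ℂ) : (((η : ℝ) : ℂ)⁻¹) • X = η⁻¹ • X := by
  rw [← Complex.ofReal_inv, Complex.coe_smul]

/-- ★ **(3.3) AT THE MEMBER = THE ROUTE'S FORWARD DERIVATIVE (1.1)₁**: `(toL2)⁻¹(D_{U₀}(toL2S λ))(b) = (D^η_{U₀,b.dir}λ)(b.src)` with `covDerivFwdT η (bgUnits F K U₀)`,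
`η = eta F n K`. [cite: Balaban1985BackgroundPropagators, (3.3) p.391; Balaban1985RegularSpaces, (1.1) p.76] -/
theorem DL2_toL2S_eq_covDerivFwdT (U₀ : GaugeField (F.P K) 0 (Matrix.specialUnitaryGroup (Fin 2) ℂ)) (l : Site (F.P K) 0 → Matrix (Fin 2) (Fin 2) ℂ)
    (b : PBond (F.P K) 0) :
    (toL2 F K c₀).symm (DL2 F n K c₀ U₀ (toL2S F K c₀ l)) b = covDerivFwdT (eta F n K) (bgUnits F K U₀) b.dir l b.src := by
  rw [DL2_apply, bgOfCfg_bondEquiv, inv_coe_smul_eq]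
  rfl

/-- ★ **(3.8) AT THE MEMBER = THE ROUTE'S COVARIANT DIVERGENCE (1.2)**: `(toL2S)⁻¹(D*_{U₀}(toL2 X))(x) = (D^{η*}_{U₀}X)(x)` with `covDivFormT η (bgUnits F K U₀)`.
[cite: Balaban1985BackgroundPropagators, (3.8) p.392, (3.5) p.391; Balaban1985RegularSpaces, (1.2) p.76] -/
theorem DstarL2_toL2_eq_covDivFormT (U₀ : GaugeField (F.P K) 0 (Matrix.specialUnitaryGroup (Fin 2) ℂ)) (X : PBond (F.P K) 0 → Matrix (Fin 2) (Fin 2) ℂ)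
    (x : Site (F.P K) 0) :
    (toL2S F K c₀).symm (DstarL2 F n K c₀ U₀ (toL2 F K c₀ X)) x = covDivFormT (eta F n K) (bgUnits F K U₀) X x := by
  rw [DstarL2_apply, inv_coe_smul_eq, covDivFormT, Finset.smul_sum]
  refine Finset.sum_congr rfl fun μ _ => ?_
  have hb : (B9SectCLatticeCarrier.unshift μ (siteEquiv F K x), μ) = bondEquiv F K ⟨x.unshift μ, μ⟩ := by
    rw [← bondEquiv_symm_unshift, Equiv.apply_symm_apply]
  rw [hb, bgOfCfg_bondEquiv, Equiv.symm_apply_apply, bondEquiv_symm_siteEquiv]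
  rfl

/-- ★ **THE READBACK `DstarPi` IS `covDivFormT η` POINTWISE.** [cite: Balaban1985BackgroundPropagators, (3.8) p.392] -/
theorem DstarPi_eq_covDivFormT (U₀ : GaugeField (F.P K) 0 (Matrix.specialUnitaryGroup (Fin 2) ℂ)) (X : PBond (F.P K) 0 → Matrix (Fin 2) (Fin 2) ℂ) :
    DstarPi F n K c₀ U₀ X = fun x => covDivFormT (eta F n K) (bgUnits F K U₀) X x := by
  funext x
  rw [DstarPi_apply, DstarL2_toL2_eq_covDivFormT]

/-! ## §3 The projected Landau member (21)ˢ in the route's divergence letter -/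

variable (h : n ≤ K) (cB : ℝ)

/-- ★★ **`IsLandauPrintS U₀ X` IS «`R_S(U₀)(D^{η*}_{U₀}X) = 0`»** with the route's own covariant divergence `covDivFormT (eta F n K) (bgUnits F K U₀) X` — print's (21)
`R(U₀)D^{η*}_{U₀}A = 0` for the averaging∕projector of record. [cite: Balaban1985Variational, (21) p.281; Balaban1985RegularSpaces, (1.38) p.82] -/
theorem isLandauPrintS_iff_covDivFormT (U₀ : GaugeField (F.P K) 0 (Matrix.specialUnitaryGroup (Fin 2) ℂ)) (X : PBond (F.P K) 0 → Matrix (Fin 2) (Fin 2) ℂ) :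
    IsLandauPrintS F n K h c₀ cB U₀ X ↔ RSPi F n K h c₀ cB U₀ (fun x => covDivFormT (eta F n K) (bgUnits F K U₀) X x) = 0 := by
  rw [Prop7SPrint.isLandauPrintS_iff, DstarPi_eq_covDivFormT]

/-- In particular a one-form with vanishing covariant divergence `D^{η*}_{U₀}X = 0` (the FULL Landau gauge) is in the projected slice (21)ˢ.
[cite: Balaban1985Variational, (21) p.281] -/
theorem isLandauPrintS_of_covDivFormT_eq_zero (U₀ : GaugeField (F.P K) 0 (Matrix.specialUnitaryGroup (Fin 2) ℂ)) (X : PBond (F.P K) 0 → Matrix (Fin 2) (Fin 2) ℂ)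
    (hX : ∀ x, covDivFormT (eta F n K) (bgUnits F K U₀) X x = 0) : IsLandauPrintS F n K h c₀ cB U₀ X := by
  rw [isLandauPrintS_iff_covDivFormT]
  have h0 : (fun x => covDivFormT (eta F n K) (bgUnits F K U₀) X x) = 0 := funext hX
  rw [h0, map_zero]

end Summit.QuantumFields.YangMills.Theorems.Prop7LandauDict

end
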